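/-
Origin: expansion seat `planner-pub-hodgecm-toy2-g2-0`, handover #5 v2 2026-08-18T05:23:52Z (`HOME/pub-hodgecm-toy2-g2/lean/Toy2g2/ToyOpenInputs.lean`, md5 ae7de3c6, 140 lines);
landed by the gen-6 packager in gate run 23 as `HodgeCM/Model/Toy/ToyOpenInputs.lean` (verbatim).
-/
/-
Copyright: pub-hodgecm formalisation cell (harness21, 2026). New file (not vendored).
Origin: session planner-pub-hodgecm-toy2-g2-0 (unit pub-hodgecm-toy2-g2, CONSISTENCY seat 2, gen 2), 2026-08-18.
WIP module `Toy2g2.ToyOpenInputs` (v2, rebased on the RUN-22 tree: M28 is toy's `HodgeCM.Model.Toy.Duality`,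
`toyModel_modelAxioms` is toy's `HodgeCM/Model/Toy/Toy.lean` v2); intended final place
`HodgeCM/Model/Toy/ToyOpenInputs.lean` (module `HodgeCM.Model.Toy.ToyOpenInputs`; kind L5).  Imports are FINAL
package names (all three modules are in gate run 22); nothing to rewrite.  No dependence on this seat's Star* files.
-/
import Summits.HodgeConjecture.HodgeCM.Model.Toy.Toy
import Summits.HodgeConjecture.HodgeCM.Model.ToyPerL
import Summits.HodgeConjecture.HodgeCM.Model.Toy.PohlmannBasis

/-!
# The open inputs in the toy universe: located exactly at the two realisation statements

`HodgeCM.Universe.OpenInputs` (StubTree/Inputs.lean) is the record of the four inputs in the cone of the headline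
theorems: `realisation_perL`, `realisation_face`, `pohlmann_span`, `qw8_sufficiency`.  In the exterior CM-model
`toyModel` — which satisfies ALL the model axioms unconditionally (toy seat's `toyModel_modelAxioms`,
`HodgeCM/Model/Toy/Toy.lean` v2 over `Duality.lean`, gate run 22) — we show:

* `toyModel_pohlmannSpan'  : toyModel.PohlmannSpan`   (pohl-g4's `toyModel_pohlmannSpan` with `M28` discharged);
* `toyModel_pohlmannBasis' : toyModel.PohlmannBasis`, `toyModel_pohlmannTheorem31' : toyModel.PohlmannTheorem31`;
* `toyModel_qw8Sufficiency : toyModel.Qw8Sufficiency` — NEW: in the toy model `alg = Hodge classes`, so by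
  `PohlmannBasis` (`B^p ⊗ ℂ = ⨆_{S Hodge} V_S`) a weight vector of a Hodge weight is a complexified algebraic class
  outright (the Lefschetz-character hypothesis of [QW8] Thm 2.5 is not even used);
* hence `toyModel_openInputs_iff : toyModel.OpenInputs ↔ (toyModel.RealisationExistsPerL ∧ toyModel.RealisationExistsFace)`
  and both sides are FALSE (`ToyPerL`): the failure of `OpenInputs` in the consistency witness is located EXACTLY at
  the two theta-realisation inputs;
* `toyModel_profile` — the full truth table of `toyModel`: `ModelAxioms`, `PohlmannSpan`, `Qw8Sufficiency`, `HC_CM`,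
  `W_RK4`, `FaceReduction`, `Lemma81` TRUE; `RealisationExistsPerL`, `RealisationExistsFace`, `PeriodThmF`, `PerL`,
  `PerL44`, `OpenInputs` FALSE;
* the separation / independence statements `exists_model_separating_realisation`,
  `realisationExistsPerL_independent`, `perL_independent`, `realisationExistsFace_independent`:
  neither realisation input, nor `PerL`, is a consequence of
  `ModelAxioms ∧ PohlmannSpan ∧ Qw8Sufficiency ∧ HC_CM ∧ W_RK4 ∧ FaceReduction ∧ Lemma81`.

So each realisation input "carries content" in the precise sense of the consistency brief: there is ONE structure
satisfying every model axiom and every other (open or proved) input of the package in which it — and the headline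
conclusion `PerL` — fails.  (A model separating the two realisation inputs from EACH OTHER, or one in which
`PohlmannSpan` / `Qw8Sufficiency` fails while `ModelAxioms` holds, is not available in the exterior family
`toyModelWith D`: there every admissible Hodge datum has the same Hodge classes, Pohlmann's theorem is a theorem of
the model, and all periods vanish; see TOY2-G2.md.)
-/

noncomputable section

namespace HodgeCM.Toy

open Literature.AlgebraicGeometry.Motives (CMType)

/-! ### `Qw8Sufficiency` in the toy model -/

/-- **[QW8] Thm 2.5 (sufficiency) holds in the toy model** (given its model axioms): since `alg = Hodge classes`
there, `PohlmannBasis` puts every weight vector of a Hodge weight inside `algC`. -/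
theorem toyModel_qw8Sufficiency_of (M : toyModel.ModelAxioms) : toyModel.Qw8Sufficiency := by
  intro F hG _h6 _hW n Θ p S x hS hx _hlef
  have hB := toyModel_pohlmannBasis M F hG n Θ p
  change x ∈ (toyModel.alg (toyModel.cmProd F Θ) p).baseChange ℂ
  have halg : toyModel.alg (toyModel.cmProd F Θ) p = toyModel.hodgeClassesOf (toyModel.cmProd F Θ) p := rfl
  rw [halg, hB]
  exact Submodule.mem_iSup_of_mem S
    (Submodule.mem_iSup_of_mem hS ((Universe.mem_weightSpace_iff F Θ S (2 * p) x).mpr hx))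

/-! ### Everything unconditional (`M28` is toy's theorem `fact_algDuality`, run 22) -/

/-- (Ported verbatim from the HodgeCMPerL package; no docstring in the source.) -/
theorem toyModel_pohlmannSpan' : toyModel.PohlmannSpan := toyModel_pohlmannSpan toyModel_modelAxioms

/-- (Ported verbatim from the HodgeCMPerL package; no docstring in the source.) -/
theorem toyModel_pohlmannBasis' : toyModel.PohlmannBasis := toyModel_pohlmannBasis toyModel_modelAxioms

/-- (Ported verbatim from the HodgeCMPerL package; no docstring in the source.) -/
theorem toyModel_pohlmannTheorem31' : toyModel.PohlmannTheorem31 :=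
  toyModel_pohlmannTheorem31 toyModel_modelAxioms

/-- (Ported verbatim from the HodgeCMPerL package; no docstring in the source.) -/
theorem toyModel_qw8Sufficiency : toyModel.Qw8Sufficiency := toyModel_qw8Sufficiency_of toyModel_modelAxioms

/-- `ModelAxioms ∧ N1 ∧ N2 ∧ N3 ∧ N4` holds in `toyModel`, unconditionally (pohl-g4's `toyModel_axiomsN`). -/
theorem toyModel_axiomsN' :
    (toyModel.ModelAxioms ∧ toyModel.Fact_cupExterior ∧ toyModel.Fact_cup_hodge ∧ toyModel.Fact_pull_H0 ∧
      toyModel.Fact_hodge_F0) ∧ ¬ toyModel.OpenInputs :=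
  toyModel_axiomsN fact_algDuality

/-- **The open inputs of `toyModel` are exactly the two realisation statements.** -/
theorem toyModel_openInputs_iff :
    toyModel.OpenInputs ↔ (toyModel.RealisationExistsPerL ∧ toyModel.RealisationExistsFace) :=
  ⟨fun h => ⟨h.realisation_perL, h.realisation_face⟩,
    fun h => ⟨h.1, h.2, toyModel_pohlmannSpan', toyModel_qw8Sufficiency⟩⟩

/-- **Truth table of the toy universe.** -/
theorem toyModel_profile :
    (toyModel.ModelAxioms ∧ toyModel.PohlmannSpan ∧ toyModel.Qw8Sufficiency ∧ toyModel.HC_CM ∧ toyModel.W_RK4 ∧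
        toyModel.FaceReduction ∧ toyModel.Lemma81) ∧
      (¬ toyModel.RealisationExistsPerL ∧ ¬ toyModel.RealisationExistsFace ∧ ¬ toyModel.PeriodThmF ∧
        ¬ toyModel.PerL ∧ ¬ toyModel.PerL44 ∧ ¬ toyModel.OpenInputs) :=
  ⟨⟨toyModel_modelAxioms, toyModel_pohlmannSpan', toyModel_qw8Sufficiency, toyModel_hc_cm, toyModel_w_rk4,
      toyModel_faceReduction, toyModel_lemma81⟩,
    ⟨toyModel_not_realisationExistsPerL, toyModel_not_realisationExistsFace, toyModel_not_periodThmF,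
      toyModel_not_perL, toyModel_not_perL44, toyModel_not_openInputs'⟩⟩

/-! ### Separation and independence -/

/-- **Separating model for the realisation inputs**: a universe with every model axiom, both combinatorial open
inputs and all four proved headline-side statements, in which both theta-realisation inputs and `PerL` fail. -/
theorem exists_model_separating_realisation :
    ∃ U : Universe, U.ModelAxioms ∧ U.PohlmannSpan ∧ U.Qw8Sufficiency ∧ U.HC_CM ∧ U.W_RK4 ∧ U.FaceReduction ∧
      U.Lemma81 ∧ ¬ U.RealisationExistsPerL ∧ ¬ U.RealisationExistsFace ∧ ¬ U.PeriodThmF ∧ ¬ U.PerL :=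
  ⟨toyModel, toyModel_modelAxioms, toyModel_pohlmannSpan', toyModel_qw8Sufficiency, toyModel_hc_cm, toyModel_w_rk4,
    toyModel_faceReduction, toyModel_lemma81, toyModel_not_realisationExistsPerL,
    toyModel_not_realisationExistsFace, toyModel_not_periodThmF, toyModel_not_perL⟩

/-- `RealisationExistsPerL` is NOT a consequence of the model axioms and the other inputs. -/
theorem realisationExistsPerL_independent :
    ¬ ∀ U : Universe, U.ModelAxioms → U.PohlmannSpan → U.Qw8Sufficiency → U.HC_CM → U.W_RK4 →
      U.FaceReduction → U.Lemma81 → U.RealisationExistsPerL :=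
  fun h => toyModel_not_realisationExistsPerL (h toyModel toyModel_modelAxioms toyModel_pohlmannSpan'
    toyModel_qw8Sufficiency toyModel_hc_cm toyModel_w_rk4 toyModel_faceReduction toyModel_lemma81)

/-- `RealisationExistsFace` is NOT a consequence of the model axioms and the other inputs. -/
theorem realisationExistsFace_independent :
    ¬ ∀ U : Universe, U.ModelAxioms → U.PohlmannSpan → U.Qw8Sufficiency → U.HC_CM → U.W_RK4 →
      U.FaceReduction → U.Lemma81 → U.RealisationExistsFace :=
  fun h => toyModel_not_realisationExistsFace (h toyModel toyModel_modelAxioms toyModel_pohlmannSpan'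
    toyModel_qw8Sufficiency toyModel_hc_cm toyModel_w_rk4 toyModel_faceReduction toyModel_lemma81)

/-- **`PerL` is NOT a consequence of the model axioms, Pohlmann's theorem, [QW8] sufficiency and the proved
headline-side statements**: its remaining content sits in the theta-realisation input. -/
theorem perL_independent :
    ¬ ∀ U : Universe, U.ModelAxioms → U.PohlmannSpan → U.Qw8Sufficiency → U.HC_CM → U.W_RK4 →
      U.FaceReduction → U.Lemma81 → U.PerL :=
  fun h => toyModel_not_perL (h toyModel toyModel_modelAxioms toyModel_pohlmannSpan'
    toyModel_qw8Sufficiency toyModel_hc_cm toyModel_w_rk4 toyModel_faceReduction toyModel_lemma81)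

/-- `PeriodThmF` (the period theorem over a general CM field) is NOT a consequence of the same. -/
theorem periodThmF_independent :
    ¬ ∀ U : Universe, U.ModelAxioms → U.PohlmannSpan → U.Qw8Sufficiency → U.HC_CM → U.W_RK4 →
      U.FaceReduction → U.Lemma81 → U.PeriodThmF :=
  fun h => toyModel_not_periodThmF (h toyModel toyModel_modelAxioms toyModel_pohlmannSpan'
    toyModel_qw8Sufficiency toyModel_hc_cm toyModel_w_rk4 toyModel_faceReduction toyModel_lemma81)

end HodgeCM.Toy

end
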